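import Summits.BirchSwinnertonDyer.BirchSwinnertonDyer.Theorems.Rank2ObservatoryRank3Row0WeakBSD
import Literature.NumberTheory.EllipticCurves.LeadingTerm
import Literature.NumberTheory.EllipticCurves.BSDInvariantsPositivityProofs
import Literature.NumberTheory.EllipticCurves.BSDInvariantsLeadingCoeffProofs
import Literature.NumberTheory.EllipticCurves.BSDShaProofs
import Literature.NumberTheory.EllipticCurves.AnalyticRankOrderProofs
import Literature.NumberTheory.EllipticCurves.RegulatorBasisProofs
import HarnessLib

/-!
# BirchSwinnertonDyer — rank ≥ 2 observatory: rank-3 census — the LEADING-TERM SIDE per row: what the REFINED conjecture (RANK ∧ SHAFIN ∧ LEAD, bsd.S03) says for each curve of the table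

HONEST FRAMING: per-curve certified theorems and census instruments; no claim on BSD in rank ≥ 2.
Nothing here proves BSD, finiteness of `Ш`, or any leading-term identity for any curve.  Every statement below is
(i) a LOGICAL CONSEQUENCE of the refined conjecture `Literature.NumberTheory.EllipticCurves.BSDConjecture` (Wiles'
Clay text, Conjecture + Remark 1; Tate 1974, Conj. 4) taken as an explicit HYPOTHESIS `hBSD` and specialised to a row
— a falsifiable PREDICTION —, or (ii) a hypothesis-free UNFOLDING of what it asserts for the row, or (iii) glue over
landed Literature theorems (positivity of the BSD quantity, reality of Taylor coefficients, Cassels–Tate as a named fact).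

Companion of the landed RANK-clause files (`…ParityBSDPrediction`, `…AnalyticDecision`, `…ShaCorankParity`): here
the clauses SHAFIN and LEAD are typed per row `r` (`E = r.curve`, a GLOBAL MINIMAL model by kernel certificate,
`Rank3Row.isGloballyMinimal_of_mem`, so `E.realPeriodRat` is the BSD period and `BSDConjecture` applies to `E`
verbatim; `rank_ℤ E(ℚ) = 3` hypothesis-free on the 9 375 rows of `Rank3KernelRankCensusN9375`):
* **HYPOTHESIS-FREE UNFOLDING** (§1): `E.BSDTriple ↔ (ord_{s=1} L(E,s) = 3 ∧ Ш(E/ℚ) finite ∧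
  L‴(E,1) = 6 · #Ш·Reg·Ω·∏c_p/(#E(ℚ)_tors)²)` (`Rank3Row.bsdTriple_iff_of_mem_rows9375`; `r! = 6`); `L‴(E,1)` is
  REAL unconditionally (`iteratedDeriv_entireLFunction_one_im`, reflection principle).
* **GRANTING `BSDConjecture` ONLY** (§1): `ord_{s=1} L(E,s) = 3`; `Ш(E/ℚ)` finite; the VALUE `L‴(E,1) = 6·bsdRHS(E)`;
  the SIGN `L‴(E,1) > 0` (every factor of the BSD quantity is positive, `bsdRHS_pos'`) — sharper than the RANK
  clause's `≠ 0` and with NO sign/modularity input; the exact «analytic Ш» identity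
  `#Ш(E) = L‴(E,1)·(#E(ℚ)_tors)²/(6·Reg·Ω·∏c_p)`; and, granting the Cassels–Tate pairing as the named fact
  `exists_casselsTate_pairing` (bsd.S18), `#Ш(E) = n²`, `n ≥ 1`: `L‴(E,1) ∈ 6·Reg·Ω·∏c_p/(#E(ℚ)_tors)² · {1,4,9,…}`.
* **GRANTING LEAD ∧ SHAFIN ONLY** (`BSDLeadingTermConjecture` + `Ш` finite), with the census's certified
  `L‴(E,1) ≠ 0` and the sign facts: the same value and sign WITHOUT the RANK clause (§1).
* §0, any `E/ℚ`: LEAD as typed FORCES SHAFIN whenever `L(E,s)` is entire (`shaFinite_of_bsdLeadingTermFormula`: the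
  junk value `#Ш = 0` would make the leading coefficient vanish, which `leadingLCoeff_ne_zero_holds` forbids); on a
  Mordell–Weil basis `P` the BSD quantity reads `#Ш·Reg(P)·Ω·∏c_p/t²`, a basis of a census curve having three points.
* §2 aggregates over the 9 375 / 9 487 pairwise distinct curves; §3 row `0` by name (`Curve5077a.E = 5077a1`): modulo
  Modularity + Gross–Zagier–Kolyvagin the RANK clause is a theorem of the tree (`…Row0WeakBSD`), so refined BSD for
  `5077a1` is EXACTLY «`Ш` finite ∧ `L‴(E,1) = 6·#Ш·Reg·Ω·∏c_p/t²»; Buhler–Gross–Zagier's `lim L(s)/(s−1)³ ≈ 1.7318`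
  (their (14)) is the real number `L‴(E,1)/3!` whose BSD-predicted value is `bsdRHS(E)`.

NOT in the kernel, not claimed: any value of `Reg`, `Ω`, `#Ш`, `c_p`, `#E(ℚ)_tors` for any row (the census's
engine-side «Ш_an ≈ 1.000» floats are data, not theorems); `Ш` finite for any row; the Cassels–Tate pairing.
Pure glue BY NAME — no definitions, no data, no numerics.  Sorry-free; no new axioms.
References: Wiles, Clay text (2006), §1; Tate, Invent. Math. 23 (1974), Conj. 4; Gross, PCMS 18 (2011), Conj. 2.10;
Silverman, AEC (2009), C.16.5, X.4.14; Cassels (1962); Buhler–Gross–Zagier, Math. Comp. 44 (1985), §4; Cremona (1997).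
-/

-- single-conjunct summit: `Summit.BirchSwinnertonDyer.BirchSwinnertonDyer.…` repeats the name by design
set_option linter.dupNamespace false

namespace Summit.BirchSwinnertonDyer.BirchSwinnertonDyer.Rank2Observatory

open Literature Literature.NumberTheory.EllipticCurves Literature.NumberTheory.EllipticCurves.ModularForms
open WeierstrassCurve
open Rank3CensusAudit (mem_rows9375_iff)

/-! ### §0 Generic glue: `E/ℚ`, the refined conjecture read at analytic rank `3` -/

section Generic

variable (W : WeierstrassCurve ℚ)

/-- Every derivative `L^{(n)}(E,1)` at `s = 1` is REAL (reflection principle, `iteratedDeriv_entireLFunction_ofReal_im`);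
unconditional, any `W/ℚ`. [cite: SilvermanAEC2009, App. C §16, Definition of L_{E/K} (p. 449)] -/
theorem iteratedDeriv_entireLFunction_one_im (n : ℕ) : (iteratedDeriv n W.entireLFunction 1).im = 0 := by
  have h := W.iteratedDeriv_entireLFunction_ofReal_im n 1
  rwa [Complex.ofReal_one] at h

/-- At analytic rank `3` the leading Taylor coefficient is `L‴(E,1)/3! = L‴(E,1)/6`.
[cite: Wiles2006BSDClay, §1, Conjecture (Birch and Swinnerton-Dyer), CMI offprint p. 2] -/
theorem leadingLCoeff_eq_of_analyticRank_eq_three (h : W.analyticRank = 3) :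
    W.leadingLCoeff = iteratedDeriv 3 W.entireLFunction 1 / 6 := by
  rw [leadingLCoeff, h]; norm_num [Nat.factorial]

/-- At analytic rank `3`, LEAD reads `L‴(E,1) = 6 · #Ш·Reg·Ω·∏c_p/(#E(ℚ)_tors)²` (identity in `ℂ`).
[cite: Wiles2006BSDClay, §1, Remarks 1 (refined conjecture), CMI offprint p. 2] [cite: Tate1974, §1 Conj. 4] -/
theorem bsdLeadingTermFormula_iff_of_analyticRank_eq_three (h : W.analyticRank = 3) :
    W.BSDLeadingTermFormula ↔ iteratedDeriv 3 W.entireLFunction 1 = 6 * (W.bsdRHS : ℂ) := by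
  unfold BSDLeadingTermFormula
  rw [leadingLCoeff_eq_of_analyticRank_eq_three W h, div_eq_iff (by norm_num : (6 : ℂ) ≠ 0)]
  constructor <;> intro h' <;> linear_combination h'

/-- At analytic rank `3`, LEAD reads `L‴(E,1) = 6 · bsdRHS(E)` as an identity of REAL numbers (`L‴(E,1)` is real).
[cite: Wiles2006BSDClay, §1, Remarks 1 (refined conjecture), CMI offprint p. 2] [cite: SilvermanAEC2009, Conj. C.16.5] -/
theorem bsdLeadingTermFormula_iff_re_of_analyticRank_eq_three (h : W.analyticRank = 3) :
    W.BSDLeadingTermFormula ↔ (iteratedDeriv 3 W.entireLFunction 1).re = 6 * W.bsdRHS := by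
  rw [bsdLeadingTermFormula_iff_of_analyticRank_eq_three W h]
  have him := iteratedDeriv_entireLFunction_one_im W 3
  constructor
  · intro h'; rw [h']; simp
  · intro h'
    exact Complex.ext (by simpa using h') (by simpa using him)

/-- **STRUCTURAL REMARK on bsd.S03 as typed: LEAD forces SHAFIN** whenever `L(E,s)` is entire: the tree's `bsdRHS`
carries the junk value `#Ш = 0` for infinite `Ш`, so LEAD would give `L^{(r)}(E,1)/r! = 0`, contradicting
`leadingLCoeff_ne_zero_holds`; hence for every `E/ℚ` with entire `L` the clause LEAD of `BSDConjecture` contains SHAFIN.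
[cite: Wiles2006BSDClay, §1, Conjecture and Remarks 1, CMI offprint p. 2] [cite: GrossPCMS2011, Conj. 2.10(2), p. 16] -/
theorem shaFinite_of_bsdLeadingTermFormula [W.IsElliptic] (hL : W.HasEntireLFunction)
    (h : W.BSDLeadingTermFormula) : W.ShaFinite := by
  by_contra hinf
  have hne : W.leadingLCoeff ≠ 0 := W.leadingLCoeff_ne_zero_holds hL
  apply hne
  have h0 : W.shaOrder = 0 := by
    unfold ShaFinite at hinf
    haveI : Infinite W.sha := not_finite_iff_infinite.mp hinf
    exact Nat.card_eq_zero_of_infinite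
  rw [h, W.bsdRHS_def, h0]; push_cast; ring

/-- LEAD ∧ SHAFIN give a POSITIVE leading coefficient `L^{(r)}(E,1)/r! = bsdRHS(E) > 0` (every factor positive:
`#Ш ≥ 1`, `Reg, Ω > 0`, `c_p, #E(ℚ)_tors ≥ 1`; tree `bsdRHS_pos'`). [cite: SilvermanAEC2009, Conj. C.16.5, Cor. VII.6.2, Prop. VIII.9.6] -/
theorem leadingLCoeff_re_pos_of_lead [W.IsElliptic] (hfin : W.ShaFinite) (h : W.BSDLeadingTermFormula) :
    0 < (W.leadingLCoeff).re := by
  rw [Iff.mp W.bsdLeadingTermFormula_iff_re_holds h]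
  exact W.bsdRHS_pos' hfin

/-- The period `Ω(W) = ∫_{E(ℝ)}|ω| > 0` of an elliptic `W/ℚ` (tree `realPeriod_pos'`). [cite: SilvermanAEC2009, Conj. C.16.5] -/
theorem realPeriodRat_pos_of_isElliptic [W.IsElliptic] : 0 < W.realPeriodRat := by
  haveI : (W.baseChange ℝ).IsElliptic := by rw [baseChange]; infer_instance
  rw [WeierstrassCurve.realPeriodRat_def]
  exact (W.baseChange ℝ).realPeriod_pos'

/-- **Rank-3 reading of LEAD ∧ SHAFIN: `L‴(E,1) > 0`** (a real number, `= 6·bsdRHS(E) > 0`).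
[cite: Wiles2006BSDClay, §1, Remarks 1 (refined conjecture), CMI offprint p. 2] [cite: SilvermanAEC2009, Conj. C.16.5] -/
theorem iteratedDeriv_three_re_pos_of_lead [W.IsElliptic] (h3 : W.analyticRank = 3) (hfin : W.ShaFinite)
    (h : W.BSDLeadingTermFormula) : 0 < (iteratedDeriv 3 W.entireLFunction 1).re := by
  rw [(bsdLeadingTermFormula_iff_re_of_analyticRank_eq_three W h3).1 h]
  exact mul_pos (by norm_num) (W.bsdRHS_pos' hfin)

/-- **Rank-3 reading of LEAD, solved for `#Ш` — the «analytic Ш» identity** `#Ш(E) = L‴(E,1)·(#E(ℚ)_tors)² /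
(6·Reg(E)·Ω(E)·∏c_p)` (denominators non-zero unconditionally; no SHAFIN needed — with infinite `Ш` both sides vanish):
the census's engine-side «Ш_an», here an exact identity CONDITIONAL on LEAD. [cite: CremonaAlgorithms1997, §3 and Tables]
[cite: Wiles2006BSDClay, §1, Remarks 1 (refined conjecture), CMI offprint p. 2] -/
theorem shaOrder_eq_of_lead_of_analyticRank_eq_three [W.IsElliptic] (h3 : W.analyticRank = 3)
    (h : W.BSDLeadingTermFormula) :
    (W.shaOrder : ℝ) = (iteratedDeriv 3 W.entireLFunction 1).re * (W.torsionOrder : ℝ) ^ 2 /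
      (6 * W.regulator * W.realPeriodRat * (W.tamagawaProduct : ℝ)) := by
  have hre := (bsdLeadingTermFormula_iff_re_of_analyticRank_eq_three W h3).1 h
  have hR : W.regulator ≠ 0 := W.regulator_pos'.ne'
  have hΩ : W.realPeriodRat ≠ 0 := (realPeriodRat_pos_of_isElliptic W).ne'
  have hc : (W.tamagawaProduct : ℝ) ≠ 0 := by exact_mod_cast W.tamagawaProduct_pos'.ne'
  have ht : (W.torsionOrder : ℝ) ≠ 0 := by exact_mod_cast W.torsionOrder_pos_holds.ne'
  have hden : 6 * W.regulator * W.realPeriodRat * (W.tamagawaProduct : ℝ) ≠ 0 :=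
    mul_ne_zero (mul_ne_zero (mul_ne_zero (by norm_num) hR) hΩ) hc
  rw [eq_div_iff hden, hre, W.bsdRHS_def]
  field_simp

/-- Granting the Cassels–Tate pairing (named fact `exists_casselsTate_pairing`, bsd.S18): a finite `Ш(E/ℚ)` has
SQUARE order `n²` with `n ≥ 1`. [cite: SilvermanAEC2009, Thm. X.4.14] [cite: Cassels1962ArithmeticIV] -/
theorem exists_shaOrder_eq_sq_of_casselsTate [W.IsElliptic] (hCT : exists_casselsTate_pairing (K := ℚ))
    (hfin : W.ShaFinite) : ∃ n : ℕ, 0 < n ∧ W.shaOrder = n ^ 2 := by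
  obtain ⟨n, hn⟩ := isSquare_shaOrder_of_casselsTate hCT W hfin
  refine ⟨n, Nat.pos_of_ne_zero ?_, by rw [hn, sq]⟩
  rintro rfl
  exact (W.shaOrder_pos hfin).ne' (by simpa using hn)

/-- **Rank-3 reading of LEAD ∧ SHAFIN ∧ Cassels–Tate: `L‴(E,1) ∈ 6·Reg·Ω·∏c_p/(#E(ℚ)_tors)² · {1, 4, 9, …}`.**
[cite: Wiles2006BSDClay, §1, Remarks 1 (refined conjecture), CMI offprint p. 2] [cite: SilvermanAEC2009, Thm. X.4.14] -/
theorem exists_iteratedDeriv_three_re_eq_of_casselsTate [W.IsElliptic] (hCT : exists_casselsTate_pairing (K := ℚ))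
    (h3 : W.analyticRank = 3) (hfin : W.ShaFinite) (h : W.BSDLeadingTermFormula) :
    ∃ n : ℕ, 0 < n ∧ (iteratedDeriv 3 W.entireLFunction 1).re =
      6 * ((n : ℝ) ^ 2 * W.regulator * W.realPeriodRat * (W.tamagawaProduct : ℝ) / (W.torsionOrder : ℝ) ^ 2) := by
  obtain ⟨n, hn, hsq⟩ := exists_shaOrder_eq_sq_of_casselsTate W hCT hfin
  refine ⟨n, hn, ?_⟩
  rw [(bsdLeadingTermFormula_iff_re_of_analyticRank_eq_three W h3).1 h, W.bsdRHS_def, hsq]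
  push_cast; ring

/-- On a Mordell–Weil basis `P` the BSD quantity reads `#Ш · Reg(P) · Ω · ∏c_p / (#E(ℚ)_tors)²`, `Reg(P) = det (⟨Pᵢ,Pⱼ⟩)`
(`regulatorOf`; independence of the basis, `IsMordellWeilBasis.regulatorOf_eq_regulator`). [cite: Gross2011, Lecture 1 §4, Def. 1.6] -/
theorem bsdRHS_eq_of_isMordellWeilBasis [W.IsElliptic] {ι : Type*} [Fintype ι] [DecidableEq ι]
    {P : ι → W.toAffine.Point} (hP : IsMordellWeilBasis P) :
    W.bsdRHS = (W.shaOrder : ℝ) * regulatorOf P * W.realPeriodRat * (W.tamagawaProduct : ℝ) /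
      (W.torsionOrder : ℝ) ^ 2 := by
  rw [W.bsdRHS_def, hP.regulatorOf_eq_regulator]

/-- For a curve with `rank_ℤ E(ℚ) = 3`: refined BSD `E.BSDTriple` IS `ord_{s=1} L(E,s) = 3 ∧ Ш(E/ℚ) finite ∧
L‴(E,1) = 6·bsdRHS(E)` (hypothesis-free unfolding). [cite: Tate1974, §1 Conj. 4] [cite: Wiles2006BSDClay, §1, Remarks 1] -/
theorem bsdTriple_iff_of_rank_eq_three (hr : W.mordellWeilRank = 3) :
    W.BSDTriple ↔ W.analyticRank = 3 ∧ Finite W.sha ∧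
      iteratedDeriv 3 W.entireLFunction 1 = 6 * (W.bsdRHS : ℂ) := by
  rw [W.bsdTriple_iff, hr]
  constructor
  · rintro ⟨h3, hfin, hL⟩
    exact ⟨h3, hfin, (bsdLeadingTermFormula_iff_of_analyticRank_eq_three W h3).1 hL⟩
  · rintro ⟨h3, hfin, hL⟩
    exact ⟨h3, hfin, (bsdLeadingTermFormula_iff_of_analyticRank_eq_three W h3).2 hL⟩

/-- A Mordell–Weil basis of a curve with `rank_ℤ E(ℚ) = 3` has exactly three points (well-definedness of the rank,
tree `card_eq_mordellWeilRank_of_isMordellWeilBasis_holds`). [cite: SilvermanAEC2009, Thm. VIII.6.7 and §VIII.10] -/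
theorem eq_three_of_isMordellWeilBasis_of_rank_eq_three [W.IsElliptic] (hr : W.mordellWeilRank = 3) {k : ℕ}
    {P : Fin k → W.toAffine.Point} (hP : IsMordellWeilBasis P) : k = 3 := by
  rw [card_eq_mordellWeilRank_of_isMordellWeilBasis_holds W hP, hr]

end Generic

/-! ### §1 Per row of the rank-3 census -/

/-- **Refined BSD SPECIALISES to every row verbatim** (the row's equation is elliptic and globally minimal, kernel):
`BSDConjecture` gives `E.BSDTriple` on ALL 9 487 rows — a consequence of the hypothesis. [cite: Wiles2006BSDClay, §1, Remarks 1] -/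
theorem Rank3Row.bsdTriple_of_bsd_of_mem {r : Rank3Row} (hr : r ∈ rank3Table) (hBSD : BSDConjecture) :
    r.curve.BSDTriple :=
  hBSD r.curve (isElliptic_of_mem hr) (Rank3Row.isGloballyMinimal_of_mem hr)

/-- **HYPOTHESIS-FREE, per row of N9375: refined BSD for the row IS
`ord_{s=1} L(E,s) = 3 ∧ Ш(E/ℚ) finite ∧ L‴(E,1) = 6·#Ш·Reg·Ω·∏c_p/(#E(ℚ)_tors)²`** (`rank_ℤ = 3` is the kernel's).
[cite: Tate1974, §1 Conj. 4] [cite: Wiles2006BSDClay, §1, Conjecture and Remarks 1, CMI offprint p. 2]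
[cite: Cassels1991LecturesEllipticCurves, §15] -/
theorem Rank3Row.bsdTriple_iff_of_mem_rows9375 {r : Rank3Row} (hr : r ∈ Rank3KernelRankCensusN9375.rows) :
    r.curve.BSDTriple ↔ r.curve.analyticRank = 3 ∧ Finite r.curve.sha ∧
      iteratedDeriv 3 r.curve.entireLFunction 1 = 6 * (r.curve.bsdRHS : ℂ) :=
  bsdTriple_iff_of_rank_eq_three r.curve (Rank3KernelRankCensusN9375.rank_eq_three r hr)

/-- **Granting `BSDConjecture` ONLY, per row of N9375: `ord_{s=1} L(E,s) = 3`, `Ш(E/ℚ)` finite, the VALUE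
`L‴(E,1) = 6·bsdRHS(E)` and the SIGN `L‴(E,1) > 0`** — no modularity, no sign facts, no numerics (the kernel's
`rank_ℤ = 3` and minimality carry the specialisation). [cite: Wiles2006BSDClay, §1, Conjecture and Remarks 1, CMI offprint p. 2]
[cite: SilvermanAEC2009, Conj. C.16.5] [cite: Cassels1991LecturesEllipticCurves, §15] -/
theorem Rank3Row.refinedBSD_of_mem_rows9375 {r : Rank3Row} (hr : r ∈ Rank3KernelRankCensusN9375.rows)
    (hBSD : BSDConjecture) :
    r.curve.analyticRank = 3 ∧ Finite r.curve.sha ∧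
      iteratedDeriv 3 r.curve.entireLFunction 1 = 6 * (r.curve.bsdRHS : ℂ) ∧
        0 < (iteratedDeriv 3 r.curve.entireLFunction 1).re := by
  have hrt : r ∈ rank3Table := (mem_rows9375_iff.1 hr).1
  haveI := isElliptic_of_mem hrt
  have hT := Rank3Row.bsdTriple_of_bsd_of_mem hrt hBSD
  obtain ⟨h3, hfin, hL⟩ := (Rank3Row.bsdTriple_iff_of_mem_rows9375 hr).1 hT
  exact ⟨h3, hfin, hL, iteratedDeriv_three_re_pos_of_lead r.curve h3 hfin hT.2.2⟩

/-- **Granting `BSDConjecture`, per row of N9375: `#Ш(E) ≥ 1` and the exact «analytic Ш» identity**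
`#Ш(E) = L‴(E,1)·(#E(ℚ)_tors)²/(6·Reg(E)·Ω(E)·∏c_p)` — the number the census's engine reports as `Ш_an ≈ 1.000…`
is, under BSD, the INTEGER `#Ш(E)`. [cite: CremonaAlgorithms1997, §3 and Tables (analytic order of Ш)]
[cite: Wiles2006BSDClay, §1, Remarks 1 (refined conjecture), CMI offprint p. 2] -/
theorem Rank3Row.shaOrder_eq_of_bsd_of_mem_rows9375 {r : Rank3Row} (hr : r ∈ Rank3KernelRankCensusN9375.rows)
    (hBSD : BSDConjecture) :
    0 < r.curve.shaOrder ∧ (r.curve.shaOrder : ℝ) =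
      (iteratedDeriv 3 r.curve.entireLFunction 1).re * (r.curve.torsionOrder : ℝ) ^ 2 /
        (6 * r.curve.regulator * r.curve.realPeriodRat * (r.curve.tamagawaProduct : ℝ)) := by
  have hrt : r ∈ rank3Table := (mem_rows9375_iff.1 hr).1
  haveI := isElliptic_of_mem hrt
  have hT := Rank3Row.bsdTriple_of_bsd_of_mem hrt hBSD
  exact ⟨r.curve.shaOrder_pos hT.2.1, shaOrder_eq_of_lead_of_analyticRank_eq_three r.curve
    ((Rank3Row.bsdTriple_iff_of_mem_rows9375 hr).1 hT).1 hT.2.2⟩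

/-- **Granting `BSDConjecture` and the Cassels–Tate pairing (named fact), per row (ALL 9 487): `#Ш(E) = n²`,
`n ≥ 1`.** [cite: SilvermanAEC2009, Thm. X.4.14] [cite: Cassels1962ArithmeticIV] -/
theorem Rank3Row.exists_shaOrder_eq_sq_of_bsd_of_mem {r : Rank3Row} (hr : r ∈ rank3Table) (hBSD : BSDConjecture)
    (hCT : exists_casselsTate_pairing (K := ℚ)) : ∃ n : ℕ, 0 < n ∧ r.curve.shaOrder = n ^ 2 := by
  haveI := isElliptic_of_mem hr
  exact exists_shaOrder_eq_sq_of_casselsTate r.curve hCT (Rank3Row.bsdTriple_of_bsd_of_mem hr hBSD).2.1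

/-- **Granting `BSDConjecture` and Cassels–Tate, per row of N9375:
`L‴(E,1) = 6·n²·Reg(E)·Ω(E)·∏c_p/(#E(ℚ)_tors)²` for some integer `n ≥ 1`.**
[cite: Wiles2006BSDClay, §1, Remarks 1 (refined conjecture), CMI offprint p. 2] [cite: SilvermanAEC2009, Thm. X.4.14] -/
theorem Rank3Row.exists_iteratedDeriv_three_re_eq_of_bsd_of_mem_rows9375 {r : Rank3Row}
    (hr : r ∈ Rank3KernelRankCensusN9375.rows) (hBSD : BSDConjecture)
    (hCT : exists_casselsTate_pairing (K := ℚ)) :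
    ∃ n : ℕ, 0 < n ∧ (iteratedDeriv 3 r.curve.entireLFunction 1).re =
      6 * ((n : ℝ) ^ 2 * r.curve.regulator * r.curve.realPeriodRat * (r.curve.tamagawaProduct : ℝ) /
        (r.curve.torsionOrder : ℝ) ^ 2) := by
  have hrt : r ∈ rank3Table := (mem_rows9375_iff.1 hr).1
  haveI := isElliptic_of_mem hrt
  have hT := Rank3Row.bsdTriple_of_bsd_of_mem hrt hBSD
  exact exists_iteratedDeriv_three_re_eq_of_casselsTate r.curve hCT
    ((Rank3Row.bsdTriple_iff_of_mem_rows9375 hr).1 hT).1 hT.2.1 hT.2.2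

/-- **GRANTING LEAD ∧ SHAFIN ONLY (no RANK clause)**, per row of the table: with the census's certified
`L‴(E,1) ≠ 0` (`hL3`), Gross–Zagier–Kolyvagin and the sign facts (which give `ord_{s=1} L(E,s) = 3`,
`Rank3Row.analyticRank_eq_three_iff_of_mem`), `BSDLeadingTermConjecture` + `Ш(E/ℚ)` finite pin the VALUE and the SIGN
of `L‴(E,1)`. [cite: Wiles2006BSDClay, §1, Remarks 1] [cite: CremonaAlgorithms1997, §2.13 p. 37] [cite: Darmon2004, Thm. 3.22] -/
theorem Rank3Row.leadingTerm_of_lead_of_mem {r : Rank3Row} (hr : r ∈ rank3Table)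
    (hLT : BSDLeadingTermConjecture) (hfin : r.curve.ShaFinite)
    (hGZK : rank_eq_analyticRank_of_analyticRank_le_one)
    (hKD : r.curve.rootNumber_eq_neg_finprod_tableLocalRootNumberAt')
    (hR : r.curve.rootNumber_eq_neg_finprod_fullTableLocalRootNumberAt)
    (hL3 : iteratedDeriv 3 r.curve.entireLFunction 1 ≠ 0) :
    iteratedDeriv 3 r.curve.entireLFunction 1 = 6 * (r.curve.bsdRHS : ℂ) ∧
      0 < (iteratedDeriv 3 r.curve.entireLFunction 1).re := by
  haveI := isElliptic_of_mem hr
  have h3 : r.curve.analyticRank = 3 := (Rank3Row.analyticRank_eq_three_iff_of_mem hr hGZK hKD hR).2 hL3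
  have hLEAD : r.curve.BSDLeadingTermFormula :=
    hLT r.curve (isElliptic_of_mem hr) (Rank3Row.isGloballyMinimal_of_mem hr) hfin
  exact ⟨(bsdLeadingTermFormula_iff_of_analyticRank_eq_three r.curve h3).1 hLEAD,
    iteratedDeriv_three_re_pos_of_lead r.curve h3 hfin hLEAD⟩

/-- Hypothesis-free, per row of N9375: **a Mordell–Weil basis of `E(ℚ)` has EXACTLY three points**, and on any such
basis `P` the BSD quantity of the row is `#Ш·Reg(P)·Ω·∏c_p/(#E(ℚ)_tors)²` with `Reg(P) = det (⟨Pᵢ,Pⱼ⟩)`.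
[cite: SilvermanAEC2009, Thm. VIII.6.7 and §VIII.10] [cite: Gross2011, Lecture 1 §4, Def. 1.6] [cite: Cassels1991LecturesEllipticCurves, §15] -/
theorem Rank3Row.eq_three_of_isMordellWeilBasis_of_mem_rows9375 {r : Rank3Row}
    (hr : r ∈ Rank3KernelRankCensusN9375.rows) {k : ℕ} {P : Fin k → r.curve.toAffine.Point}
    (hP : IsMordellWeilBasis P) :
    k = 3 ∧ r.curve.bsdRHS = (r.curve.shaOrder : ℝ) * regulatorOf P * r.curve.realPeriodRat *
      (r.curve.tamagawaProduct : ℝ) / (r.curve.torsionOrder : ℝ) ^ 2 := by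
  haveI := isElliptic_of_mem (mem_rows9375_iff.1 hr).1
  exact ⟨eq_three_of_isMordellWeilBasis_of_rank_eq_three r.curve (Rank3KernelRankCensusN9375.rank_eq_three r hr) hP,
    bsdRHS_eq_of_isMordellWeilBasis r.curve hP⟩

/-! ### §2 Aggregated statements -/

/-- **HEADLINE (refined BSD's predictions over GRAND census N9375).** Granting `BSDConjecture` ONLY, there are
**9 375 pairwise DISTINCT elliptic curves over `ℚ`, each a global minimal model of conductor `< 5·10⁵` with
`rank_ℤ E(ℚ) = 3` (kernel), for which `ord_{s=1} L(E,s) = 3`, `Ш(E/ℚ)` is finite, `L‴(E,1) = 6·bsdRHS(E)` and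
`L‴(E,1) > 0`** — 9 375 falsifiable sign-and-value predictions, no other input. [cite: CremonaAlgorithms1997, Tables, §3]
[cite: Wiles2006BSDClay, §1, Conjecture and Remarks 1, CMI offprint p. 2] [cite: Cassels1991LecturesEllipticCurves, §15] -/
theorem refinedBSD_predicts_rows9375 (hBSD : BSDConjecture) :
    ∃ l : List (WeierstrassCurve ℚ), l.Nodup ∧ l.length = 9375 ∧
      ∀ E ∈ l, E.IsElliptic ∧ E.IsGloballyMinimal ∧ E.conductorNorm ℤ < 500000 ∧ E.mordellWeilRank = 3 ∧
        E.analyticRank = 3 ∧ Finite E.sha ∧ iteratedDeriv 3 E.entireLFunction 1 = 6 * (E.bsdRHS : ℂ) ∧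
          0 < (iteratedDeriv 3 E.entireLFunction 1).re := by
  refine ⟨Rank3KernelRankCensusN9375.rows.map Rank3Row.curve, Rank3Joins112.rows9375_curves_nodup,
    by rw [List.length_map, Rank3KernelRankCensusN9375.rows_length], ?_⟩
  intro E hE
  obtain ⟨r, hr, rfl⟩ := List.mem_map.1 hE
  have hrt : r ∈ rank3Table := (mem_rows9375_iff.1 hr).1
  exact ⟨isElliptic_of_mem hrt, Rank3Row.isGloballyMinimal_of_mem hrt, Rank3Row.conductorNorm_lt_of_mem hrt,
    Rank3KernelRankCensusN9375.rank_eq_three r hr, Rank3Row.refinedBSD_of_mem_rows9375 hr hBSD⟩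

/-- **Whole table (9 487 distinct curves, `rank_ℤ ≥ 3` kernel): granting `BSDConjecture`, each satisfies
`E.BSDTriple`, so `ord_{s=1} L(E,s) = rank_ℤ E(ℚ) ≥ 3`, `Ш(E/ℚ)` is finite and `L^{(r)}(E,1)/r! = bsdRHS(E) > 0`.**
[cite: Wiles2006BSDClay, §1, Conjecture and Remarks 1, CMI offprint p. 2] [cite: CremonaAlgorithms1997, Tables, §3] -/
theorem refinedBSD_predicts_table (hBSD : BSDConjecture) :
    ∃ l : List (WeierstrassCurve ℚ), l.Nodup ∧ l.length = 9487 ∧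
      ∀ E ∈ l, E.IsElliptic ∧ E.IsGloballyMinimal ∧ E.conductorNorm ℤ < 500000 ∧ 3 ≤ E.mordellWeilRank ∧
        E.BSDTriple ∧ 3 ≤ E.analyticRank ∧ 0 < (E.leadingLCoeff).re := by
  refine ⟨rank3Table.map Rank3Row.curve, rank3Table_curves_nodup, by rw [List.length_map, rank3Table_length], ?_⟩
  intro E hE
  obtain ⟨r, hr, rfl⟩ := List.mem_map.1 hE
  haveI := isElliptic_of_mem hr
  have hT := Rank3Row.bsdTriple_of_bsd_of_mem hr hBSD
  refine ⟨isElliptic_of_mem hr, Rank3Row.isGloballyMinimal_of_mem hr, Rank3Row.conductorNorm_lt_of_mem hr,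
    three_le_mordellWeilRank_of_mem_rank3Table r hr, hT, ?_, leadingLCoeff_re_pos_of_lead r.curve hT.2.1 hT.2.2⟩
  rw [show r.curve.analyticRank = r.curve.mordellWeilRank from hT.1]
  exact three_le_mordellWeilRank_of_mem_rank3Table r hr

/-- **`BSDConjecture` restricted to GRAND census N9375 is EXACTLY 9 375 concrete triples** (hypothesis-free):
`(∀ rows, E.BSDTriple) ↔ ∀ rows, (ord_{s=1} L(E,s) = 3 ∧ Ш finite ∧ L‴(E,1) = 6·bsdRHS(E))`; `BSDConjecture` gives
the left-hand side (`Rank3Row.bsdTriple_of_bsd_of_mem`). [cite: Tate1974, §1 Conj. 4]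
[cite: Wiles2006BSDClay, §1, Conjecture and Remarks 1, CMI offprint p. 2] -/
theorem bsdTriple_rows9375_iff :
    (∀ r ∈ Rank3KernelRankCensusN9375.rows, r.curve.BSDTriple) ↔
      ∀ r ∈ Rank3KernelRankCensusN9375.rows, r.curve.analyticRank = 3 ∧ Finite r.curve.sha ∧
        iteratedDeriv 3 r.curve.entireLFunction 1 = 6 * (r.curve.bsdRHS : ℂ) :=
  ⟨fun h r hr => (Rank3Row.bsdTriple_iff_of_mem_rows9375 hr).1 (h r hr),
    fun h r hr => (Rank3Row.bsdTriple_iff_of_mem_rows9375 hr).2 (h r hr)⟩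

/-! ### §3 Row `0`: `5077a1` (Buhler–Gross–Zagier) -/

/-- `Curve5077a.E : y² + y = x³ − 7x + 6` is a GLOBAL MINIMAL model (the census's kernel certificate for row `0`,
transported along `curve_row0_eq`). [cite: BuhlerGrossZagier1985, §1 (p. 473)] [cite: SilvermanAEC2009, VII.1 Remark 1.1] -/
theorem curve5077a_isGloballyMinimal : Curve5077a.E.IsGloballyMinimal := by
  rw [← curve_row0_eq]; exact Rank3Row.isGloballyMinimal_of_mem (List.getElem_mem _)

/-- **Refined BSD for `5077a1`, unfolded hypothesis-free**: `E.BSDTriple ↔ (ord_{s=1} L(E,s) = 3 ∧ Ш finite ∧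
L‴(E,1) = 6·bsdRHS(E))` (`rank_ℤ = 3` by certificate, `curve5077a_mordellWeilRank_eq_three`).
[cite: BuhlerGrossZagier1985, §4 (14)] [cite: Tate1974, §1 Conj. 4] -/
theorem curve5077a_bsdTriple_iff :
    Curve5077a.E.BSDTriple ↔ Curve5077a.E.analyticRank = 3 ∧ Finite Curve5077a.E.sha ∧
      iteratedDeriv 3 Curve5077a.E.entireLFunction 1 = 6 * (Curve5077a.E.bsdRHS : ℂ) :=
  bsdTriple_iff_of_rank_eq_three Curve5077a.E curve5077a_mordellWeilRank_eq_three

/-- **Modulo Modularity + Gross–Zagier–Kolyvagin the RANK clause of `5077a1` is a THEOREM of the tree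
(`ord_{s=1} L(E,s) = 3 = rank_ℤ`), so refined BSD for `5077a1` is EXACTLY «`Ш(E/ℚ)` finite ∧
`L‴(E,1) = 6·#Ш·Reg·Ω·∏c_p/(#E(ℚ)_tors)²`».** [cite: BuhlerGrossZagier1985, §4 (11), (14)] [cite: GrossZagier1986, (8.2)–(8.3)]
[cite: Wiles2006BSDClay, §1, Conjecture and Remarks 1, CMI offprint p. 2] -/
theorem curve5077a_bsdTriple_iff_of_modularity_GZK (hmod : exists_isNewformOf)
    (hGZK : rank_eq_analyticRank_of_analyticRank_le_one) :
    Curve5077a.E.BSDTriple ↔ Finite Curve5077a.E.sha ∧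
      iteratedDeriv 3 Curve5077a.E.entireLFunction 1 = 6 * (Curve5077a.E.bsdRHS : ℂ) := by
  rw [curve5077a_bsdTriple_iff]
  exact ⟨fun h => h.2, fun h => ⟨Curve5077a.analyticRank_E_eq_three_of_modularity_GZK hmod hGZK, h⟩⟩

/-- Modulo Modularity + GZK, **`L‴(5077a1, 1)` is a NON-ZERO REAL number** (reality unconditional; non-vanishing
`Curve5077a.iteratedDeriv_three_entireLFunction_E_ne_zero`) — Buhler–Gross–Zagier's `L‴(1)/3! ≈ 1.7318`; refined
BSD predicts its SIGN and VALUE (next theorem). [cite: BuhlerGrossZagier1985, §4 (14)] [cite: SilvermanAEC2009, App. C §16] -/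
theorem curve5077a_iteratedDeriv_three_real_ne_zero (hmod : exists_isNewformOf)
    (hGZK : rank_eq_analyticRank_of_analyticRank_le_one) :
    (iteratedDeriv 3 Curve5077a.E.entireLFunction 1).im = 0 ∧
      (iteratedDeriv 3 Curve5077a.E.entireLFunction 1).re ≠ 0 := by
  have him := iteratedDeriv_entireLFunction_one_im Curve5077a.E 3
  refine ⟨him, fun hre => Curve5077a.iteratedDeriv_three_entireLFunction_E_ne_zero hmod hGZK ?_⟩
  exact Complex.ext (by simpa using hre) (by simpa using him)

/-- **Refined BSD's prediction for `5077a1`, granting LEAD ∧ SHAFIN only** (`BSDLeadingTermConjecture` + `Ш`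
finite; RANK discharged by Modularity + GZK): `L‴(E,1) = 6·bsdRHS(E) > 0` and
`#Ш(E) = L‴(E,1)·(#E(ℚ)_tors)²/(6·Reg·Ω·∏c_p)`. (BGZ report `∏c_p = 1`, `E(ℚ)_tors = 0`, `Ш_an ≈ 1` — data, not
kernel facts here.) [cite: BuhlerGrossZagier1985, §4 (11)–(14)] [cite: Wiles2006BSDClay, §1, Remarks 1, CMI offprint p. 2] -/
theorem curve5077a_refinedBSD_prediction (hmod : exists_isNewformOf)
    (hGZK : rank_eq_analyticRank_of_analyticRank_le_one) (hLT : BSDLeadingTermConjecture)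
    (hfin : Curve5077a.E.ShaFinite) :
    iteratedDeriv 3 Curve5077a.E.entireLFunction 1 = 6 * (Curve5077a.E.bsdRHS : ℂ) ∧
      0 < (iteratedDeriv 3 Curve5077a.E.entireLFunction 1).re ∧
        (Curve5077a.E.shaOrder : ℝ) = (iteratedDeriv 3 Curve5077a.E.entireLFunction 1).re *
          (Curve5077a.E.torsionOrder : ℝ) ^ 2 /
            (6 * Curve5077a.E.regulator * Curve5077a.E.realPeriodRat * (Curve5077a.E.tamagawaProduct : ℝ)) := by
  have h3 := Curve5077a.analyticRank_E_eq_three_of_modularity_GZK hmod hGZK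
  have hLEAD : Curve5077a.E.BSDLeadingTermFormula :=
    hLT Curve5077a.E inferInstance curve5077a_isGloballyMinimal hfin
  exact ⟨(bsdLeadingTermFormula_iff_of_analyticRank_eq_three _ h3).1 hLEAD,
    iteratedDeriv_three_re_pos_of_lead _ h3 hfin hLEAD, shaOrder_eq_of_lead_of_analyticRank_eq_three _ h3 hLEAD⟩

end Summit.BirchSwinnertonDyer.BirchSwinnertonDyer.Rank2Observatory
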